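import Mathlib
import Summits.MatrixMultiplication.Statement
import Summits.MatrixMultiplication.MatrixMultiplication.Theorems.GraphEquationsNullExpLadder

/-!
# Graph equations — ISOLATION ORDER DOES NOT BOUND THE MEMBERSHIP EXPONENT (M19g)

The algebra behind NODE-g32 rev 4 («NER is strictly stronger than OR′ as a property of
families»), kernel-checked in a polynomial ring `ℂ[X_i : i ∈ σ]` with `J = (X_i² : i ∈ σ)`:

* `mk_sum_X_pow_card` — in `ℂ[X]/J`:  `(Σ_{i∈S} X_i)^{|S|} = |S|! · ∏_{i∈S} X_i`  (the algebra of
  `|S|` dual numbers; induction on `S` with the nilpotent binomial formula `add_pow_of_sq_zero`).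
* `prod_X_notMem_span_sq` — `∏_{i∈S} X_i ∉ J` (a square-free monomial in a monomial ideal of squares).
* **`sum_X_pow_card_notMem_span_sq`**, **`sum_X_pow_card_succ_mem_span_sq`** — the linear form
  `s = Σ_{i∈S} X_i` has `s^{|S|} ∉ J` and `s^{|S|+1} ∈ J`: its MEMBERSHIP EXPONENT modulo the
  squares is EXACTLY `|S| + 1`, although the forms `X_i²` have only the trivial common zero
  (`eq_zero_of_eval_sq_eq_zero`: ISOLATION ORDER `2`).

READING FOR THE ROUTE (remark; the system-level packaging is routine circuit bookkeeping not done
here).  Order the `n²` positions linearly and take the tests `t_i = (f_i + f_{i+1})²` (`i < n²`),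
`t_{n²} = f_{n²}²`: a CORRECT system (the forms `ℓ_i = F_i + F_{i+1}`, `ℓ_{n²} = F_{n²}` are a basis)
of cost `N_gen + 2n²`, whose test ideal is initially isolated to order `K = 2` at EVERY base, while
`F_1 = ℓ_1 − ℓ_2 + ⋯ ± ℓ_{n²}` has all `ℓ`-coordinates nonzero, so by the theorems below (with
`X_i ↦ ±ℓ_i(f)`, over the residue field of any base) `f_1^e ∈ J_E ⟺ e ≥ n² + 1`.  Bounded isolation
order (OR′, rung `K = 2` of BOP′ decides this family) does not bound the membership exponent (no
fixed rung NEP_e applies): the e-ladder of `GraphEquationsNullExpLadder` is residual-free in its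
finite range but its asymptotic half NER is a strictly stronger family property than OR′.
-/

set_option linter.dupNamespace false

noncomputable section

open scoped BigOperators

namespace Summit.MatrixMultiplication.MatrixMultiplication.Theorems.GraphEquations

open MvPolynomial

variable {σ : Type*}

/-- Nilpotent binomial formula: `x² = 0 ⇒ (x + y)^{c+1} = y^{c+1} + (c+1)·x·y^c`. -/
theorem add_pow_of_sq_zero {R : Type*} [CommRing R] {x : R} (hx : x ^ 2 = 0) (y : R) :
    ∀ c : ℕ, (x + y) ^ (c + 1) = y ^ (c + 1) + ((c : R) + 1) * x * y ^ c
  | 0 => by simp [add_comm]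
  | c + 1 => by
    have hx' : x * x = 0 := by rw [← pow_two, hx]
    rw [pow_succ, add_pow_of_sq_zero hx y c]
    push_cast
    linear_combination ((c : R) + 1) * y ^ c * hx'

/-- `X_a² ∈ J`. -/
theorem X_sq_mem_span_sq (a : σ) :
    (X a : MvPolynomial σ ℂ) ^ 2 ∈ Ideal.span (Set.range fun i : σ => (X i : MvPolynomial σ ℂ) ^ 2) :=
  Ideal.subset_span ⟨a, rfl⟩

/-- `X_i · ∏_{j∈S} X_j ∈ J` for `i ∈ S`. -/
theorem X_mul_prod_X_mem_span_sq [DecidableEq σ] {S : Finset σ} {i : σ} (hi : i ∈ S) :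
    (X i : MvPolynomial σ ℂ) * ∏ j ∈ S, X j ∈
      Ideal.span (Set.range fun i : σ => (X i : MvPolynomial σ ℂ) ^ 2) := by
  rw [← Finset.mul_prod_erase S (fun j => (X j : MvPolynomial σ ℂ)) hi, ← mul_assoc, ← pow_two]
  exact Ideal.mul_mem_right _ _ (X_sq_mem_span_sq i)

/-- `(Σ_{i∈S} X_i) · ∏_{j∈S} X_j ∈ J`. -/
theorem sum_X_mul_prod_X_mem_span_sq [DecidableEq σ] (S : Finset σ) :
    (∑ i ∈ S, (X i : MvPolynomial σ ℂ)) * ∏ j ∈ S, X j ∈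
      Ideal.span (Set.range fun i : σ => (X i : MvPolynomial σ ℂ) ^ 2) := by
  rw [Finset.sum_mul]
  exact Ideal.sum_mem _ fun i hi => X_mul_prod_X_mem_span_sq hi

/-- **THE ALGEBRA OF DUAL NUMBERS.**  In `ℂ[X]/(X_i²)`: `(Σ_{i∈S} X_i)^{|S|} = |S|!·∏_{i∈S} X_i`. -/
theorem mk_sum_X_pow_card [DecidableEq σ] (S : Finset σ) :
    Ideal.Quotient.mk (Ideal.span (Set.range fun i : σ => (X i : MvPolynomial σ ℂ) ^ 2))
        ((∑ i ∈ S, X i) ^ S.card) =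
      (S.card.factorial : MvPolynomial σ ℂ ⧸ Ideal.span (Set.range fun i : σ => (X i : MvPolynomial σ ℂ) ^ 2)) *
        Ideal.Quotient.mk (Ideal.span (Set.range fun i : σ => (X i : MvPolynomial σ ℂ) ^ 2)) (∏ i ∈ S, X i) := by
  induction S using Finset.induction_on with
  | empty => simp
  | @insert a S ha ih =>
    have hx : (Ideal.Quotient.mk (Ideal.span (Set.range fun i : σ => (X i : MvPolynomial σ ℂ) ^ 2)) (X a)) ^ 2 = 0 := by
      rw [← map_pow, Ideal.Quotient.eq_zero_iff_mem]; exact X_sq_mem_span_sq a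
    have h0 : Ideal.Quotient.mk (Ideal.span (Set.range fun i : σ => (X i : MvPolynomial σ ℂ) ^ 2)) (∏ j ∈ S, X j) *
        Ideal.Quotient.mk (Ideal.span (Set.range fun i : σ => (X i : MvPolynomial σ ℂ) ^ 2)) (∑ i ∈ S, X i) = 0 := by
      rw [mul_comm, ← map_mul, Ideal.Quotient.eq_zero_iff_mem]; exact sum_X_mul_prod_X_mem_span_sq S
    have ih' : (Ideal.Quotient.mk (Ideal.span (Set.range fun i : σ => (X i : MvPolynomial σ ℂ) ^ 2)) (∑ i ∈ S, X i)) ^ S.card =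
        (S.card.factorial : MvPolynomial σ ℂ ⧸ Ideal.span (Set.range fun i : σ => (X i : MvPolynomial σ ℂ) ^ 2)) *
          Ideal.Quotient.mk (Ideal.span (Set.range fun i : σ => (X i : MvPolynomial σ ℂ) ^ 2)) (∏ i ∈ S, X i) := by
      rw [← map_pow]; exact ih
    rw [Finset.sum_insert ha, Finset.prod_insert ha, Finset.card_insert_of_notMem ha, map_pow, map_add,
      add_pow_of_sq_zero hx, pow_succ, ih', map_mul, Nat.factorial_succ]
    push_cast
    linear_combination (S.card.factorial : MvPolynomial σ ℂ ⧸ Ideal.span (Set.range fun i : σ => (X i : MvPolynomial σ ℂ) ^ 2)) * h0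

/-- `∏_{i∈S} X_i` is the monomial `X^{𝟙_S}`. -/
theorem prod_X_eq_monomial [DecidableEq σ] (S : Finset σ) :
    ∏ i ∈ S, (X i : MvPolynomial σ ℂ) = monomial (∑ i ∈ S, Finsupp.single i 1) 1 := by
  induction S using Finset.induction_on with
  | empty => simp
  | @insert a S ha ih =>
    rw [Finset.prod_insert ha, Finset.sum_insert ha, ih, X, monomial_mul, one_mul]

/-- **A square-free monomial is not in the ideal of squares**: `∏_{i∈S} X_i ∉ (X_i² : i)`. -/
theorem prod_X_notMem_span_sq [DecidableEq σ] (S : Finset σ) :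
    ∏ i ∈ S, (X i : MvPolynomial σ ℂ) ∉ Ideal.span (Set.range fun i : σ => (X i : MvPolynomial σ ℂ) ^ 2) := by
  have hJ : (Set.range fun i : σ => (X i : MvPolynomial σ ℂ) ^ 2) =
      (fun d => monomial d (1 : ℂ)) '' Set.range fun i : σ => (Finsupp.single i 2 : σ →₀ ℕ) := by
    ext p
    simp only [Set.mem_range, Set.mem_image, exists_exists_eq_and, X_pow_eq_monomial]
  rw [hJ, mem_ideal_span_monomial_image, prod_X_eq_monomial]
  intro h
  obtain ⟨d, ⟨i, rfl⟩, hle⟩ := h (∑ i ∈ S, Finsupp.single i 1)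
    (by rw [support_monomial, if_neg one_ne_zero]; exact Finset.mem_singleton_self _)
  have h2 : (Finsupp.single i 2 : σ →₀ ℕ) i ≤ (∑ j ∈ S, Finsupp.single j 1 : σ →₀ ℕ) i := hle i
  simp only [Finsupp.single_eq_same, Finsupp.coe_finsetSum, Finset.sum_apply, Finsupp.single_apply] at h2
  rw [Finset.sum_ite_eq'] at h2
  split_ifs at h2 <;> omega

/-- **ISOLATION ORDER `2`**: the squares `X_i²` have only the trivial common zero. -/
theorem eq_zero_of_eval_sq_eq_zero (v : σ → ℂ) (h : ∀ i, eval v ((X i : MvPolynomial σ ℂ) ^ 2) = 0) :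
    v = 0 := by
  funext i
  have := h i
  rw [map_pow, eval_X] at this
  exact pow_eq_zero_iff (n := 2) (by norm_num) |>.mp this

/-- **MEMBERSHIP EXPONENT `> |S|`**: `(Σ_{i∈S} X_i)^{|S|} ∉ (X_i² : i)`. -/
theorem sum_X_pow_card_notMem_span_sq [DecidableEq σ] (S : Finset σ) :
    (∑ i ∈ S, (X i : MvPolynomial σ ℂ)) ^ S.card ∉
      Ideal.span (Set.range fun i : σ => (X i : MvPolynomial σ ℂ) ^ 2) := by
  intro h
  have hfac : IsUnit (S.card.factorial :
      MvPolynomial σ ℂ ⧸ Ideal.span (Set.range fun i : σ => (X i : MvPolynomial σ ℂ) ^ 2)) := by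
    rw [← map_natCast (algebraMap ℂ (MvPolynomial σ ℂ ⧸
      Ideal.span (Set.range fun i : σ => (X i : MvPolynomial σ ℂ) ^ 2)))]
    exact (isUnit_iff_ne_zero.mpr (by exact_mod_cast Nat.factorial_ne_zero S.card)).map _
  have hS := mk_sum_X_pow_card S
  rw [Ideal.Quotient.eq_zero_iff_mem.mpr h, eq_comm, hfac.mul_right_eq_zero, Ideal.Quotient.eq_zero_iff_mem] at hS
  exact prod_X_notMem_span_sq S hS

/-- **MEMBERSHIP EXPONENT `= |S| + 1`**: `(Σ_{i∈S} X_i)^{|S|+1} ∈ (X_i² : i)`. -/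
theorem sum_X_pow_card_succ_mem_span_sq [DecidableEq σ] (S : Finset σ) :
    (∑ i ∈ S, (X i : MvPolynomial σ ℂ)) ^ (S.card + 1) ∈
      Ideal.span (Set.range fun i : σ => (X i : MvPolynomial σ ℂ) ^ 2) := by
  rw [← Ideal.Quotient.eq_zero_iff_mem, map_pow, pow_succ', ← map_pow, mk_sum_X_pow_card, mul_left_comm,
    ← map_mul, Ideal.Quotient.eq_zero_iff_mem.mpr (sum_X_mul_prod_X_mem_span_sq S), mul_zero]

end Summit.MatrixMultiplication.MatrixMultiplication.Theorems.GraphEquations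

end
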